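import Summits.QuantumFields.YangMills.Theorems.UnitScaleTiltProp7GaugeProjectorSupPackagePin
import Summits.QuantumFields.YangMills.Theorems.UnitScaleTiltProp7PcolMember
import Summits.QuantumFields.YangMills.Theorems.UnitScaleTiltProp7ChainPotentialHessianFamily
import HarnessLib

/-!
# Route `UnitScaleTilt`, crux K1 «MinimiserStabilityRegPr» (stmt-QuantumFields-19200), EX row (5) `norm_G` ∕ STOREY H — **THE PLAIN `R_S` FIBRE-SUP LETTER `hR` AT ONE MEMBER AND
# FOR ALL MEMBERS** (`‖R_S g‖_∞ ≤ C_R·‖g‖_∞` in the fibre currency — the `hR` binder of ✓`Prop7StoreyHValueRows.storeyH_value_rows`, H8 ✓p777341, H8-R ✓p779509, H8-R′ v2 ✓p780956):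
# px5's PIN→MEMBER recipe (✓`Prop7GaugeProjectorSupPackageMember`, (c1)(c2)(c3)) run ONCE MORE on the plain-`R_S` pin row ✓`Prop7GaugeProjectorSupPackagePin.norm_equiv_RS_le_pin` — the one
# value letter of STOREY H that had no member∕family edition in the tree (px17 g13 LOCATE 17:26:08Z).  Letter assembly (`hcol` ⟸ ✓`hcol_of_massiveColumn_decay`, `hGsup` ⟸ ✓`hGsup_of_regPr`,
# the (COL) window ✓`window_delta`∕✓`window_win`, unit leaves ✓`unitU3_pin`∕`unitU1_pin`∕`unitA_pin`∕`unitP1_pin`∕`unitP2_pin`) is px5 g13–g15's, copied VERBATIM with credit; the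
# families-of-record wrapper (`Q″ ← exists_intertwiner_of_regPr`, `hRS ← RS_eq_projR_of_lift`, `ι` by `rfl`, `T := (ι∘Q″)†`, `G ← exists_massive_inverse`) likewise; the family edition
# follows px17 g12's ✓`Prop7ChainPotentialHessianFamily.hc1_hc3_sup_family` (rows first by unification, signs after).

Cell `ym3-torus` (HUMAN RULING D-0037; rung R3 = SU(2) YM₃ on T³ — NOT d = 4, NOT infinite volume, NOT a mass gap, NOT Clay).  Width seat `ym3-torus-px17` (gen 13).  THEOREMS ONLY
(0 `def`, 0 `sorry`; decl-local `maxHeartbeats 400000` on §1 and §2, disclosed — px5's measured class for the ~2-kchar closed constants); `--supports stmt-QuantumFields-19200 --as helper`;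
count-neutral.

WHAT IS PROVED (ns `Summit.QuantumFields.YangMills.Theorems.Prop7GaugeProjectorRSSupMember`).
* §1 ★★ `norm_equiv_RS_le_member` — at one member, LOD letters at the pin displayed (`Q″ hseq hRS`, `ι hι T hT G hAG hGA`, mass `0 < am`), `RegPr F n K ε₀ U₀` (`10⁷L³ε₀ ≤ 1`):
  `∀ g Gb, (∀ y, ‖g y‖ ≤ Gb) → ∀ y, ‖(R_S g) y‖ ≤ C_R⋆(am)·Gb` with `C_R⋆(am)` MEMBER-FREE (numerals and `am` only).
* §2 ★★★ `norm_equiv_RS_le_member_of_lift` — the same with the families of record discharged; displayed: `RegPr` (`10¹²L³ε₀ ≤ 1`), the face's Lift antecedent.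
* §3 ★★★ `hR_sup_family` — for ALL members: `∃ C_R : ℕ → ℝ`, `0 ≤ C_R L`, and under `RegPr ρ U₀`, `ρ ≤ αH L` (✓`alphaH_pos`'s cap), Lift: the `hR` binder text of H8∕H8-R∕H8-R′
  (`am := 1`).  No room, no coupling window (the letter has no `a`).
HYP-SAT (★★OWNER RULING №42).  `RegPr`∕cap∕Lift only (classes of record); conclusions = real sup inequalities, `0 ≤ 0` at `g = 0`; no `Prop` placeholder.
HONEST SCOPE.  A re-run of landed machinery at one more row; no new estimate; nothing of `h3`∕`norm_G`∕EX∕19200∕R3 is proved; the Yang–Mills mass gap is NOT proved.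

References: T. Bałaban, CMP **99** (1985) 389–434 [Balaban1985BackgroundPropagators] ((3.20)–(3.25) p.394, Thm 3.1 (3.42)∕(3.46) pp.397–398, (3.49) p.399, (3.114)–(3.122) pp.418–420);
CMP **102** (1985) 277–309 [Balaban1985Variational] ((138)–(139) p.299).
-/

set_option autoImplicit false

noncomputable section

open scoped BigOperators Matrix.Norms.L2Operator InnerProductSpace ComplexConjugate Matrix

namespace Summit.QuantumFields.YangMills.Theorems.Prop7GaugeProjectorRSSupMember

open Literature.MathematicalPhysics.QuantumFieldTheory.Balaban1983to89
open Literature.MathematicalPhysics.QuantumFieldTheory.Balaban1983to89.T3ContinuumYM3Torus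
open T4Continuum BlockAveraging
open BlockAveraging (Idx)
open B7Prop1Explicit (disp)
open B5Eq118OneStroke (iterBlockOf)
open B15DeterminingSets (embIter)
open B10Eq27TorusAxialLog (holT transl)
open B7TransferAnalyticMean (meanCLM)
open B4Sect5Torus (TSite)
open B9SectCLatticeCarrier (Bond)
open B9Eq311L2Pairing (WL2)
open B11Eq103H1Complex (SiteL2K BondL2K projR)
open Summit.QuantumFields.YangMills.Theorems.Prop8Chart (emlIterU)
open T3SectALandauChart (eta eta_pos bgUnits)
open T3PrintedRegularMinimiser (RegPr)
open T3PrintedRegularOrbits (sites_eq)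
open T3LevelShift (siteShift)
open Summit.QuantumFields.YangMills.Theorems.Prop7SectET3Transport (periodsT3 siteEquiv bondEquiv)
open Summit.QuantumFields.YangMills.Theorems.Prop7SectET3HilbertLetters (W₂ toL2 toL2S DL2 DstarL2 covLapSite)
open Summit.QuantumFields.YangMills.Theorems.Prop7SectET3GaugeProjector (NS RS)
open Summit.QuantumFields.YangMills.Theorems.Prop7SectET3DeltaPiPInv (kerDProj GprimeP)
open Summit.QuantumFields.YangMills.Theorems.Prop7LODSlotK2WindowLetters (window_delta window_win)
open Summit.QuantumFields.YangMills.Theorems.Prop7ComplementaryProjectorPointwiseDecayClosed (hcol_of_massiveColumn_decay)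
open Summit.QuantumFields.YangMills.Theorems.Prop7MassiveSolutionGradientSupOfRegPr (hGsup_of_regPr hT1_of_regPr)
open Summit.QuantumFields.YangMills.Theorems.Prop7CurvedMemberGradientRowPin (unitA_pin unitU1_pin unitU3_pin)
open Summit.QuantumFields.YangMills.Theorems.Prop7CurvedMemberLocalGradient (exists_curved_localGradient)
open Summit.QuantumFields.YangMills.Theorems.AxialGaugeChartGlue (norm_bgOfCfg_axialT_sub_le)
open Summit.QuantumFields.YangMills.Theorems.Prop7NSIntertwinerOfRecord (exists_intertwiner_of_regPr)
open Summit.QuantumFields.YangMills.Theorems.Prop7RSEqPrintProjectorOfLift (RS_eq_projR_of_lift)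
open Summit.QuantumFields.YangMills.Theorems.Prop7MassivePropagatorCoercive (exists_massive_inverse)
open Summit.QuantumFields.YangMills.Theorems.Prop7PcolMember (unitP1_pin unitP3_pin unitP2_pin)
open Summit.QuantumFields.YangMills.Theorems.Prop7GaugeProjectorSupPackagePin (norm_equiv_RS_le_pin)
open Summit.QuantumFields.YangMills.Theorems.Prop7ChainPotentialHessianFamily (alphaH_pos alphaH_window_member)
open Literature.MathematicalPhysics.QuantumFieldTheory.Balaban1983to89.T3PrintedMinimiserExistence (regPr_mono)

variable (F : T3Family) {n K : ℕ} (h : n ≤ K) {c₀ cB : ℝ} [Fact (0 < c₀)] [Fact (0 < cB)]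
  {ε₀ : ℝ} (hε₀ : 0 < ε₀) (hε7 : 10 ^ 7 * (F.L : ℝ) ^ 3 * ε₀ ≤ 1)
  (U₀ : GaugeField (F.P K) 0 (Matrix.specialUnitaryGroup (Fin 2) ℂ)) (hreg : RegPr F n K ε₀ U₀)
  (Q'' : SiteL2K ℂ 3 (periodsT3 F K) c₀ W₂ →ₗ[ℂ] (Site (F.P K) (K - n) → Matrix (Fin 2) (Fin 2) ℂ))
  (hseq : ∀ lam : Site (F.P K) 0 → Matrix (Fin 2) (Fin 2) ℂ, ∃ ns : (j : ℕ) → Site (F.P K) j → Matrix (Fin 2) (Fin 2) ℂ, ns 0 = lam ∧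
      (∀ (j : ℕ) (y : Site (F.P K) (j + 1)), ns (j + 1) y = ns j (emb y) - meanCLM (Idx (F.P K)) (Matrix (Fin 2) (Fin 2) ℂ) fun i : Idx (F.P K) =>
        ns j (emb y) - ((holT (emlIterU j (bgUnits F K U₀)) (emb y) (stairWord i.2.1 (off i.1)) : (Matrix (Fin 2) (Fin 2) ℂ)ˣ) : Matrix (Fin 2) (Fin 2) ℂ) *
          ns j (transl (emb y) (disp (stairWord i.2.1 (off i.1)))) * (((holT (emlIterU j (bgUnits F K U₀)) (emb y) (stairWord i.2.1 (off i.1)))⁻¹ : (Matrix (Fin 2) (Fin 2) ℂ)ˣ) : Matrix (Fin 2) (Fin 2) ℂ)) ∧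
      ns (K - n) = Q'' (toL2S F K c₀ lam))
  (hRS : RS F n K h c₀ cB U₀ = projR (covLapSite F n K c₀ U₀) Q'')
  (hker : LinearMap.ker Q'' ≤ NS F n K h c₀ cB U₀)

/-! ## §1 The plain `R_S` sup row at one member (LOD letters displayed) -/

omit [Fact (0 < cB)] in
include hε₀ hε7 hreg hseq hRS in
-- HEARTBEAT rule (README): the ~4-kchar closed constant is matched by `rw … at hfin; exact hfin` (syntactic after the unit leaves); measured to fit a decl-local 400000 like PIN-B's `hPcol_member`; disclosed.
set_option maxHeartbeats 400000 in
/-- ★★ **THE PLAIN `R_S` FIBRE-SUP ROW AT ONE MEMBER, EVERY (L3′b) LETTER DISCHARGED, MEMBER-FREE CONSTANT** (PIN ✓`norm_equiv_RS_le_pin` at V5b's `hcol`, px12's `hGsup` from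
`RegPr`, unit leaves ✓`unitU3_pin`∕`unitU1_pin`∕`unitA_pin`∕`unitP1_pin`∕`unitP2_pin`; px5's assembly verbatim); displayed: `RegPr` (`10⁷L³ε₀ ≤ 1`), the LOD data at the pin with mass `0 < am`, `hseq`, `hRS`.
[cite: Balaban1985BackgroundPropagators, (3.20)–(3.25) p.394, Thm 3.1 (3.42) p.397, (3.49) p.399; Balaban1985Variational, (138)–(139) p.299] -/
theorem norm_equiv_RS_le_member (hnK : n < K) {am : ℝ} (ham : 0 < am) [hc₁ : Fact (0 < c₀ * ((F.L : ℝ) ^ 3) ^ (K - n))]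
    (ι : (Site (F.P K) (K - n) → Matrix (Fin 2) (Fin 2) ℂ) →ₗ[ℂ] SiteL2K ℂ 3 (periodsT3 F n) (c₀ * ((F.L : ℝ) ^ 3) ^ (K - n)) W₂)
    (hι : ∀ c, ι c = toL2S F n (c₀ * ((F.L : ℝ) ^ 3) ^ (K - n)) (fun z => c (siteShift (sites_eq F n K h) z)))
    (T : SiteL2K ℂ 3 (periodsT3 F n) (c₀ * ((F.L : ℝ) ^ 3) ^ (K - n)) W₂ →ₗ[ℂ] SiteL2K ℂ 3 (periodsT3 F K) c₀ W₂)
    (hT : ∀ (l : SiteL2K ℂ 3 (periodsT3 F K) c₀ W₂) (f : SiteL2K ℂ 3 (periodsT3 F n) (c₀ * ((F.L : ℝ) ^ 3) ^ (K - n)) W₂), ⟪ι (Q'' l), f⟫_ℂ = ⟪l, T f⟫_ℂ)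
    (G : SiteL2K ℂ 3 (periodsT3 F K) c₀ W₂ →ₗ[ℂ] SiteL2K ℂ 3 (periodsT3 F K) c₀ W₂)
    (hAG : ∀ f, covLapSite F n K c₀ U₀ (G f) + (am : ℂ) • T (ι (Q'' (G f))) = f)
    (hGA : ∀ u, G (covLapSite F n K c₀ U₀ u + (am : ℂ) • T (ι (Q'' u))) = u)
    (g : SiteL2K ℂ 3 (periodsT3 F K) c₀ W₂) (Gb : ℝ) (hg : ∀ y, ‖WL2.equiv ℂ _ W₂ g y‖ ≤ Gb) (y : TSite 3 (periodsT3 F K)) :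
    ‖WL2.equiv ℂ _ W₂ (RS F n K h c₀ cB U₀ g) y‖ 
      ≤ (1 + (14 * (8 * Real.exp (3 * min (1 / (10 * Real.sqrt (max 2 (16 / am)) * Real.sqrt (27 + 2025 / 8 * am))) (1 / 4)) * (1 + Real.exp (3 * (1 / (10 * Real.sqrt (max 2 (16 / am)) * Real.sqrt (27 + 2025 / 8 * am)))) * (am * (5 / 4 * Real.sqrt 2) * Real.sqrt (25 / 8) * (8 * Real.sqrt (max 2 (16 / am)) ^ 2)))) + Real.sqrt 216 * (Real.sqrt (8 * Real.exp (3 * min (1 / (10 * Real.sqrt (max 2 (16 / am)) * Real.sqrt (27 + 2025 / 8 * am))) (1 / 4)) * Real.exp (6 * (1 / (10 * Real.sqrt (max 2 (16 / am)) * Real.sqrt (27 + 2025 / 8 * am)))) * (2 * (1 + 1 / (1 / (10 * Real.sqrt (max 2 (16 / am)) * Real.sqrt (27 + 2025 / 8 * am))))) ^ 3) * (8 * Real.sqrt (max 2 (16 / am)) ^ 2))) * (2 * (1 + 1 / (min (1 / (10 * Real.sqrt (max 2 (16 / am)) * Real.sqrt (27 + 2025 / 8 * am))) (1 / 4) / 2)))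 ^ 3 * (10 * (18 / (2 / ((1 + 25 / 8) * (600 * (27 / 4) ^ 6 + am))) ^ 2) * (4 * (2 * (1 + 1 / min (1 / (10 * Real.sqrt (max 2 (16 / am)) * Real.sqrt (27 + 2025 / 8 * am)) / 2) (2 / ((1 + 25 / 8) * (600 * (27 / 4) ^ 6 + am)) / (3 * (Real.sqrt (max 2 (16 / am)) * (2 + Real.sqrt (max 2 (16 / am))) * (3 * Real.sqrt 3 + 27 + 9 * Real.sqrt am * Real.sqrt (25 / 8) + 81 * am * (25 / 8)) * (8 * Real.sqrt (max 2 (16 / am)) + 8 * Real.sqrt (max 2 (16 / am)) ^ 2) * (10 * Real.sqrt (25 / 8)) + 9 * max 2 (16 / am) * Real.sqrt (25 / 8)))))) ^ 3) * ((14 * (8 * Real.exp (3 * min (1 / (10 * Real.sqrt (max 2 (16 / am)) * Real.sqrt (27 + 2025 / 8 * am))) (1 / 4)) * (5 / 2 + Real.exp (3 * (1 / (10 * Real.sqrt (max 2 (16 / am)) * Real.sqrt (27 + 2025 / 8 * am)))) * (am * (5 / 2) * (25 / 8) * (8 * max 2 (16 / am))))) + Real.sqrt 432 * (Real.sqrt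 (8 * Real.exp (3 * min (1 / (10 * Real.sqrt (max 2 (16 / am)) * Real.sqrt (27 + 2025 / 8 * am))) (1 / 4)) * Real.exp (6 * (1 / (10 * Real.sqrt (max 2 (16 / am)) * Real.sqrt (27 + 2025 / 8 * am)))) * (2 * (1 + 1 / (1 / (10 * Real.sqrt (max 2 (16 / am)) * Real.sqrt (27 + 2025 / 8 * am))))) ^ 3) * (8 * max 2 (16 / am) * Real.sqrt (25 / 8)))) * (2 * (1 + 1 / (min (1 / (10 * Real.sqrt (max 2 (16 / am)) * Real.sqrt (27 + 2025 / 8 * am))) (1 / 4) / 2))) ^ 3))) * Gb := by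
  have hc₀ : 0 < c₀ := Fact.out
  have hc₁ : 0 < c₀ * ((F.L : ℝ) ^ 3) ^ (K - n) := hc₁.out
  have hL1 : (1 : ℝ) < F.L := by exact_mod_cast F.hL.2
  have hL0 : (0 : ℝ) < F.L := by linarith
  have hLP := (F.P K).L_pos
  -- the pin's raw letters
  have hsx : (25 / 8) * (c₀ * ((F.L : ℝ) ^ 3) ^ (K - n) * ((((F.P K).L : ℝ) ^ (F.P K).d) ^ (K - n))⁻¹ / c₀) = 25 / 8 := by
    rw [show ((F.P K).L : ℝ) = (F.L : ℝ) from rfl, T3Family.P_d]; field_simp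
  have hMraw : 16 * c₀ * ((F.L : ℝ) ^ (K - n)) ^ 3 / (am * (c₀ * ((F.L : ℝ) ^ 3) ^ (K - n))) = 16 / am := by
    rw [← pow_mul, ← pow_mul, Nat.mul_comm]; field_simp
  have hM : max 2 (16 * c₀ * ((F.L : ℝ) ^ (K - n)) ^ 3 / (am * (c₀ * ((F.L : ℝ) ^ 3) ^ (K - n)))) = max 2 (16 / am) := by rw [hMraw]
  have hη : 0 < eta F n K := eta_pos F n K
  have hη1 : eta F n K ≤ 1 := by
    show ((F.L : ℝ)⁻¹) ^ (K - n) ≤ 1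
    exact pow_le_one₀ (inv_nonneg.2 hL0.le) (inv_le_one_of_one_le₀ hL1.le)
  -- the column window at slope `μ(am)` (W1: `window_delta` for `3μ ≤ 1`, `window_win` with EQUALITY at `μ(am)`)
  have hM'2 : (2 : ℝ) ≤ max 2 (16 / am) := le_max_left _ _
  have hcδ1 : (1 : ℝ) ≤ 27 + 2025 / 8 * am := by linarith [ham.le]
  have hsM1 : 1 ≤ Real.sqrt (max 2 (16 / am)) := Real.one_le_sqrt.2 (by linarith)
  have hsc1 : 1 ≤ Real.sqrt (27 + 2025 / 8 * am) := Real.one_le_sqrt.2 hcδ1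
  have hμ0 : 0 < (1 / (10 * Real.sqrt (max 2 (16 / am)) * Real.sqrt (27 + 2025 / 8 * am))) := by positivity
  have hμ10 : 10 * (1 / (10 * Real.sqrt (max 2 (16 / am)) * Real.sqrt (27 + 2025 / 8 * am))) ≤ 1 := by
    have h1 : (1 : ℝ) ≤ Real.sqrt (max 2 (16 / am)) * Real.sqrt (27 + 2025 / 8 * am) := one_le_mul_of_one_le_of_one_le hsM1 hsc1
    rw [show 10 * (1 / (10 * Real.sqrt (max 2 (16 / am)) * Real.sqrt (27 + 2025 / 8 * am))) = 1 / (Real.sqrt (max 2 (16 / am)) * Real.sqrt (27 + 2025 / 8 * am)) by field_simp]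
    rw [div_le_one (by positivity)]
    exact h1
  have hμ3 : 3 * (1 / (10 * Real.sqrt (max 2 (16 / am)) * Real.sqrt (27 + 2025 / 8 * am))) ≤ 1 := by linarith
  have hδ := window_delta (a := am) (sx := ((25 / 8) * (c₀ * ((F.L : ℝ) ^ 3) ^ (K - n) * ((((F.P K).L : ℝ) ^ (F.P K).d) ^ (K - n))⁻¹ / c₀))) (η := eta F n K) ham hsx hη hη1 hμ0.le hμ3
  have hwin := window_win ham hM
  -- the three letters at the pin
  have hcol := hcol_of_massiveColumn_decay F h hε₀ hε7 U₀ hreg Q'' hseq ι hι T hT ham G hAG hμ0 (δ₂ := Real.sqrt (27 + 2025 / 8 * am) * (1 / (10 * Real.sqrt (max 2 (16 / am)) * Real.sqrt (27 + 2025 / 8 * am)))) (by positivity) hδ hwin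
  have hGsup := hGsup_of_regPr F h hε₀ hε7 U₀ hreg Q'' hseq ι hι T hT ham G hAG hμ0 (δ₁ := Real.sqrt (27 + 2025 / 8 * am) * (1 / (10 * Real.sqrt (max 2 (16 / am)) * Real.sqrt (27 + 2025 / 8 * am)))) (by positivity) hδ hwin
  have hκ : 0 < min (1 / (10 * Real.sqrt (max 2 (16 / am)) * Real.sqrt (27 + 2025 / 8 * am))) (1 / 4) / 2 := by positivity
  have hCpt : 0 ≤ (14 * (8 * Real.exp (3 * min (1 / (10 * Real.sqrt (max 2 (16 / am)) * Real.sqrt (27 + 2025 / 8 * am))) (1 / 4)) * ((5 / 4) * Real.sqrt (2 * (c₀ * ((F.L : ℝ) ^ 3) ^ (K - n))) * ((((F.P K).L : ℝ) ^ (F.P K).d) ^ (K - n))⁻¹ / c₀ * Real.sqrt (2 * (c₀ * ((F.L : ℝ) ^ 3) ^ (K - n))) + Real.exp (3 * (1 / (10 * Real.sqrt (max 2 (16 / am)) * Real.sqrt (27 + 2025 / 8 * am)))) * ((am * ((5 / 4) * Real.sqrt (2 * (c₀ * ((F.L : ℝ) ^ 3) ^ (K - n))) * ((((F.P K).L : ℝ)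 ^ (F.P K).d) ^ (K - n))⁻¹ / c₀) * Real.sqrt ((25 / 8) * ((c₀ * ((F.L : ℝ) ^ 3) ^ (K - n)) * ((((F.P K).L : ℝ) ^ (F.P K).d) ^ (K - n))⁻¹ / c₀))) * ((8 * Real.sqrt (max 2 (16 * c₀ * ((F.L : ℝ) ^ (K - n)) ^ 3 / (am * (c₀ * ((F.L : ℝ) ^ 3) ^ (K - n))))) ^ 2) * (Real.sqrt ((25 / 8) * ((c₀ * ((F.L : ℝ) ^ 3) ^ (K - n)) * ((((F.P K).L : ℝ) ^ (F.P K).d) ^ (K - n))⁻¹ / c₀)) * Real.sqrt (2 * (c₀ * ((F.L : ℝ) ^ 3) ^ (K - n))))))))) + (Real.sqrt (3 ^ 3 / (c₀ * ((F.L : ℝ) ^ (K - n)) ^ 3) * 8) * (Real.sqrt (8 * Real.exp (3 * min (1 / (10 * Real.sqrt (max 2 (16 / am)) * Real.sqrt (27 + 2025 / 8 * am))) (1 / 4)) * Real.exp (6 * (1 / (10 * Real.sqrt (max 2 (16 / am)) * Real.sqrt (27 + 2025 / 8 * am)))) * (2 * (1 + 1 / (1 / (10 * Real.sqrt (max 2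 (16 / am)) * Real.sqrt (27 + 2025 / 8 * am))))) ^ 3) * ((8 * Real.sqrt (max 2 (16 * c₀ * ((F.L : ℝ) ^ (K - n)) ^ 3 / (am * (c₀ * ((F.L : ℝ) ^ 3) ^ (K - n))))) ^ 2) * (Real.sqrt ((25 / 8) * ((c₀ * ((F.L : ℝ) ^ 3) ^ (K - n)) * ((((F.P K).L : ℝ) ^ (F.P K).d) ^ (K - n))⁻¹ / c₀)) * Real.sqrt (2 * (c₀ * ((F.L : ℝ) ^ 3) ^ (K - n))))))) := by positivity
  -- the PIN at these letters
  have hfin := norm_equiv_RS_le_pin F h hε₀ hε7 U₀ hreg Q'' hseq hRS hnK ham ι hι T hT G hAG hGA hκ hCpt hcol hGsup g Gb hg y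
  -- the leaves
  rw [unitU3_pin F hc₀ ham, unitU1_pin F hc₀ ham, unitA_pin F hc₀, unitP1_pin F hc₀ ham, unitP2_pin F hc₀ ham] at hfin
  exact hfin

/-! ## §2 The same with the families of record discharged (Lift antecedent displayed) -/

section Member
omit [Fact (0 < cB)] in
include hε₀ hreg in
set_option maxHeartbeats 400000 in
/-- ★★★ **THE PLAIN `R_S` FIBRE-SUP ROW AT ONE MEMBER, FAMILIES OF RECORD DISCHARGED** — with `Q″ hseq hker ← exists_intertwiner_of_regPr`, `hRS ← RS_eq_projR_of_lift (hLift)`, `ι` by `rfl`,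
`T := (ι∘Q″)†`, `G ← exists_massive_inverse` (mass `am`); displayed: `RegPr F n K ε₀ U₀` with `10¹²L³ε₀ ≤ 1`, the face's Lift antecedent; constant = the member's (px5's wrapper verbatim).
[cite: Balaban1985BackgroundPropagators, (3.20)–(3.25) p.394, Thm 3.1 (3.42) p.397, (3.49) p.399; Balaban1985Variational, (138)–(139) p.299] -/
theorem norm_equiv_RS_le_member_of_lift (hnK : n < K) (hε12 : 10 ^ 12 * (F.L : ℝ) ^ 3 * ε₀ ≤ 1) {am : ℝ} (ham : 0 < am)
    (hLift : ∀ cf : Site (F.P K) (K - n) → Matrix (Fin 2) (Fin 2) ℂ,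
      (∀ e : PBond (F.P K) (K - n), cf e.src = ((emlIterU (K - n) (bgUnits F K U₀) e : (Matrix (Fin 2) (Fin 2) ℂ)ˣ) : Matrix (Fin 2) (Fin 2) ℂ) * cf e.tgt *
        (((emlIterU (K - n) (bgUnits F K U₀) e)⁻¹ : (Matrix (Fin 2) (Fin 2) ℂ)ˣ) : Matrix (Fin 2) (Fin 2) ℂ)) →
      ∃ l₀ : Site (F.P K) 0 → Matrix (Fin 2) (Fin 2) ℂ,
        (∀ b : PBond (F.P K) 0, l₀ b.src = ((bgUnits F K U₀ b : (Matrix (Fin 2) (Fin 2) ℂ)ˣ) : Matrix (Fin 2) (Fin 2) ℂ) * l₀ b.tgt * (((bgUnits F K U₀ b)⁻¹ : (Matrix (Fin 2) (Fin 2) ℂ)ˣ) : Matrix (Fin 2) (Fin 2) ℂ)) ∧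
        ∀ y : Site (F.P K) (K - n), l₀ (embIter (K - n) y) = cf y)
    (g : SiteL2K ℂ 3 (periodsT3 F K) c₀ W₂) (Gb : ℝ) (hg : ∀ y, ‖WL2.equiv ℂ _ W₂ g y‖ ≤ Gb) (y : TSite 3 (periodsT3 F K)) :
    ‖WL2.equiv ℂ _ W₂ (RS F n K h c₀ cB U₀ g) y‖ 
      ≤ (1 + (14 * (8 * Real.exp (3 * min (1 / (10 * Real.sqrt (max 2 (16 / am)) * Real.sqrt (27 + 2025 / 8 * am))) (1 / 4)) * (1 + Real.exp (3 * (1 / (10 * Real.sqrt (max 2 (16 / am)) * Real.sqrt (27 + 2025 / 8 * am)))) * (am * (5 / 4 * Real.sqrt 2) * Real.sqrt (25 / 8) * (8 * Real.sqrt (max 2 (16 / am)) ^ 2)))) + Real.sqrt 216 * (Real.sqrt (8 * Real.exp (3 * min (1 / (10 * Real.sqrt (max 2 (16 / am)) * Real.sqrt (27 + 2025 / 8 * am))) (1 / 4)) * Real.exp (6 * (1 / (10 * Real.sqrt (max 2 (16 / am)) * Real.sqrt (27 + 2025 / 8 * am)))) * (2 * (1 + 1 / (1 / (10 * Real.sqrt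 (max 2 (16 / am)) * Real.sqrt (27 + 2025 / 8 * am))))) ^ 3) * (8 * Real.sqrt (max 2 (16 / am)) ^ 2))) * (2 * (1 + 1 / (min (1 / (10 * Real.sqrt (max 2 (16 / am)) * Real.sqrt (27 + 2025 / 8 * am))) (1 / 4) / 2))) ^ 3 * (10 * (18 / (2 / ((1 + 25 / 8) * (600 * (27 / 4) ^ 6 + am))) ^ 2) * (4 * (2 * (1 + 1 / min (1 / (10 * Real.sqrt (max 2 (16 / am)) * Real.sqrt (27 + 2025 / 8 * am)) / 2) (2 / ((1 + 25 / 8) * (600 * (27 / 4) ^ 6 + am)) / (3 * (Real.sqrt (max 2 (16 / am)) * (2 + Real.sqrt (max 2 (16 / am))) * (3 * Real.sqrt 3 + 27 + 9 * Real.sqrt am * Real.sqrt (25 / 8) + 81 * am * (25 / 8)) * (8 * Real.sqrt (max 2 (16 / am)) + 8 * Real.sqrt (max 2 (16 / am)) ^ 2) * (10 * Real.sqrt (25 / 8)) + 9 * max 2 (16 / am) * Real.sqrt (25 / 8)))))) ^ 3) * ((14 * (8 * Real.exp (3 * min (1 / (10 * Real.sqrt (max 2 (16 / am)) * Real.sqrt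 (27 + 2025 / 8 * am))) (1 / 4)) * (5 / 2 + Real.exp (3 * (1 / (10 * Real.sqrt (max 2 (16 / am)) * Real.sqrt (27 + 2025 / 8 * am)))) * (am * (5 / 2) * (25 / 8) * (8 * max 2 (16 / am))))) + Real.sqrt 432 * (Real.sqrt (8 * Real.exp (3 * min (1 / (10 * Real.sqrt (max 2 (16 / am)) * Real.sqrt (27 + 2025 / 8 * am))) (1 / 4)) * Real.exp (6 * (1 / (10 * Real.sqrt (max 2 (16 / am)) * Real.sqrt (27 + 2025 / 8 * am)))) * (2 * (1 + 1 / (1 / (10 * Real.sqrt (max 2 (16 / am)) * Real.sqrt (27 + 2025 / 8 * am))))) ^ 3) * (8 * max 2 (16 / am) * Real.sqrt (25 / 8)))) * (2 * (1 + 1 / (min (1 / (10 * Real.sqrt (max 2 (16 / am)) * Real.sqrt (27 + 2025 / 8 * am))) (1 / 4) / 2))) ^ 3))) * Gb := by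
  have hc₀ : 0 < c₀ := Fact.out
  have hL : (0 : ℝ) < F.L := by have := F.hL.2; exact_mod_cast (by omega : 0 < F.L)
  have hε7 : 10 ^ 7 * (F.L : ℝ) ^ 3 * ε₀ ≤ 1 := by
    have h1 : (10 : ℝ) ^ 7 * (F.L : ℝ) ^ 3 * ε₀ ≤ 10 ^ 12 * (F.L : ℝ) ^ 3 * ε₀ := by
      have : 0 ≤ (F.L : ℝ) ^ 3 * ε₀ := by positivity
      nlinarith
    exact h1.trans hε12
  -- the `Q″` of record, its ∃-form top-mean clause and `ker Q″ ≤ N_S`; the Lift identity `R_S = projR Δ Q″`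
  obtain ⟨Q'', D', -, -, htop, hseq, hker⟩ := exists_intertwiner_of_regPr F h (c₀ := c₀) cB hε₀ hε12 U₀ hreg
  have hRS := RS_eq_projR_of_lift F h cB hε₀ hε12 U₀ hreg hLift Q'' htop hker
  -- the LOD data at the pinned weight: `ι` by `rfl`, `T := (ι∘Q″)†`, `G ← exists_massive_inverse`
  haveI : Fact (0 < c₀ * ((F.L : ℝ) ^ 3) ^ (K - n)) := ⟨by positivity⟩
  obtain ⟨ι', hι'⟩ : ∃ ι' : (Site (F.P K) (K - n) → Matrix (Fin 2) (Fin 2) ℂ) →ₗ[ℂ] SiteL2K ℂ 3 (periodsT3 F n) (c₀ * ((F.L : ℝ) ^ 3) ^ (K - n)) W₂,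
      ∀ c, ι' c = toL2S F n (c₀ * ((F.L : ℝ) ^ 3) ^ (K - n)) (fun z => c (siteShift (sites_eq F n K h) z)) :=
    ⟨(toL2S F n (c₀ * ((F.L : ℝ) ^ 3) ^ (K - n))).toLinearMap ∘ₗ LinearMap.funLeft ℂ (Matrix (Fin 2) (Fin 2) ℂ) (siteShift (sites_eq F n K h)), fun c => rfl⟩
  obtain ⟨T', hT'⟩ : ∃ T' : SiteL2K ℂ 3 (periodsT3 F n) (c₀ * ((F.L : ℝ) ^ 3) ^ (K - n)) W₂ →ₗ[ℂ] SiteL2K ℂ 3 (periodsT3 F K) c₀ W₂,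
      ∀ (l : SiteL2K ℂ 3 (periodsT3 F K) c₀ W₂) (f : SiteL2K ℂ 3 (periodsT3 F n) (c₀ * ((F.L : ℝ) ^ 3) ^ (K - n)) W₂), ⟪ι' (Q'' l), f⟫_ℂ = ⟪l, T' f⟫_ℂ :=
    ⟨LinearMap.adjoint (ι' ∘ₗ Q''), fun l f => by rw [LinearMap.adjoint_inner_right, LinearMap.comp_apply]⟩
  obtain ⟨G', hAG', hGA', -⟩ := exists_massive_inverse F h hε₀ hε7 U₀ hreg Q'' hseq ι' hι' T' hT' ham
  exact norm_equiv_RS_le_member F h hε₀ hε7 U₀ hreg Q'' hseq hRS hnK ham ι' hι' T' hT' G' hAG' hGA' g Gb hg y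

end Member

/-! ## §3 ★★★ The `hR` letter for every member of every family, `C_R` ∃-packaged (L-only) -/

omit [Fact (0 < cB)] in
/-- ★★★ **THE PLAIN `R_S` FIBRE-SUP LETTER `hR` FOR EVERY MEMBER OF EVERY FAMILY, L-ONLY CONSTANT `0 ≤ C_R L`** — under `RegPr ρ U₀`, `ρ ≤ αH L` (✓`alphaH_pos`'s cap, which carries
`10¹²L³ρ ≤ 1` at the member ✓`alphaH_window_member`) and the face's Lift antecedent: H8∕H8-R∕H8-R′'s `hR` binder text
`∀ g Gb, (∀ y, ‖g y‖ ≤ Gb) → ∀ y, ‖(R_S g) y‖ ≤ C_R L·Gb` — §2 at `am := 1`; witness by unification, sign by `positivity` (px17 g12's ✓`hc1_hc3_sup_family` pattern).  No room, no coupling.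
[cite: Balaban1985BackgroundPropagators, (3.20)–(3.25) p.394, Thm 3.1 (3.42) p.397, (3.49) p.399; Balaban1985Variational, (138)–(139) p.299] -/
theorem hR_sup_family (c₀ cB : ℕ → ℝ) [hc₀ : ∀ L : ℕ, Fact (0 < c₀ L)] :
    ∃ CR : ℕ → ℝ, (∀ L : ℕ, 1 < L → 0 ≤ CR L) ∧
      ∀ (L : ℕ), 1 < L → ∀ (i : T3Thm1Carrier.Idx L) (U₀ : GaugeField (i.1.1.P i.1.2.2) 0 (Matrix.specialUnitaryGroup (Fin 2) ℂ)), ∀ ρ : ℝ, RegPr i.1.1 i.1.2.1 i.1.2.2 ρ U₀ →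
        ρ ≤ min (1 / (10 ^ 12 * (L : ℝ) ^ 3)) (1 / (2 * ((exists_curved_localGradient.choose + 1) * (48 * (6 * Real.sqrt 2 * Real.sqrt 10 + 6 * Real.sqrt 2))))) →
        (∀ cf : Site (i.1.1.P i.1.2.2) (i.1.2.2 - i.1.2.1) → Matrix (Fin 2) (Fin 2) ℂ,
        (∀ e' : PBond (i.1.1.P i.1.2.2) (i.1.2.2 - i.1.2.1), cf e'.src = ((emlIterU (i.1.2.2 - i.1.2.1) (bgUnits i.1.1 i.1.2.2 U₀) e' : (Matrix (Fin 2) (Fin 2) ℂ)ˣ) : Matrix (Fin 2) (Fin 2) ℂ) * cf e'.tgt *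
        (((emlIterU (i.1.2.2 - i.1.2.1) (bgUnits i.1.1 i.1.2.2 U₀) e')⁻¹ : (Matrix (Fin 2) (Fin 2) ℂ)ˣ) : Matrix (Fin 2) (Fin 2) ℂ)) →
        ∃ l₀ : Site (i.1.1.P i.1.2.2) 0 → Matrix (Fin 2) (Fin 2) ℂ,
        (∀ b' : PBond (i.1.1.P i.1.2.2) 0, l₀ b'.src = ((bgUnits i.1.1 i.1.2.2 U₀ b' : (Matrix (Fin 2) (Fin 2) ℂ)ˣ) : Matrix (Fin 2) (Fin 2) ℂ) * l₀ b'.tgt * (((bgUnits i.1.1 i.1.2.2 U₀ b')⁻¹ : (Matrix (Fin 2) (Fin 2) ℂ)ˣ) : Matrix (Fin 2) (Fin 2) ℂ)) ∧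
        ∀ y : Site (i.1.1.P i.1.2.2) (i.1.2.2 - i.1.2.1), l₀ (embIter (i.1.2.2 - i.1.2.1) y) = cf y) →
      ∀ (g : SiteL2K ℂ 3 (periodsT3 i.1.1 i.1.2.2) (c₀ L) W₂) (Gb : ℝ), (∀ y, ‖WL2.equiv ℂ _ W₂ g y‖ ≤ Gb) →
        ∀ y, ‖WL2.equiv ℂ _ W₂ (RS i.1.1 i.1.2.1 i.1.2.2 i.2.2.le (c₀ L) (cB L) U₀ g) y‖ ≤ CR L * Gb := by
  -- rows FIRST (the proof assembles `CR` by unification), sign SECOND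
  have key : ∃ CR : ℕ → ℝ, (∀ (L : ℕ), 1 < L → ∀ (i : T3Thm1Carrier.Idx L) (U₀ : GaugeField (i.1.1.P i.1.2.2) 0 (Matrix.specialUnitaryGroup (Fin 2) ℂ)), ∀ ρ : ℝ, RegPr i.1.1 i.1.2.1 i.1.2.2 ρ U₀ →
        ρ ≤ min (1 / (10 ^ 12 * (L : ℝ) ^ 3)) (1 / (2 * ((exists_curved_localGradient.choose + 1) * (48 * (6 * Real.sqrt 2 * Real.sqrt 10 + 6 * Real.sqrt 2))))) →
        (∀ cf : Site (i.1.1.P i.1.2.2) (i.1.2.2 - i.1.2.1) → Matrix (Fin 2) (Fin 2) ℂ,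
        (∀ e' : PBond (i.1.1.P i.1.2.2) (i.1.2.2 - i.1.2.1), cf e'.src = ((emlIterU (i.1.2.2 - i.1.2.1) (bgUnits i.1.1 i.1.2.2 U₀) e' : (Matrix (Fin 2) (Fin 2) ℂ)ˣ) : Matrix (Fin 2) (Fin 2) ℂ) * cf e'.tgt *
        (((emlIterU (i.1.2.2 - i.1.2.1) (bgUnits i.1.1 i.1.2.2 U₀) e')⁻¹ : (Matrix (Fin 2) (Fin 2) ℂ)ˣ) : Matrix (Fin 2) (Fin 2) ℂ)) →
        ∃ l₀ : Site (i.1.1.P i.1.2.2) 0 → Matrix (Fin 2) (Fin 2) ℂ,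
        (∀ b' : PBond (i.1.1.P i.1.2.2) 0, l₀ b'.src = ((bgUnits i.1.1 i.1.2.2 U₀ b' : (Matrix (Fin 2) (Fin 2) ℂ)ˣ) : Matrix (Fin 2) (Fin 2) ℂ) * l₀ b'.tgt * (((bgUnits i.1.1 i.1.2.2 U₀ b')⁻¹ : (Matrix (Fin 2) (Fin 2) ℂ)ˣ) : Matrix (Fin 2) (Fin 2) ℂ)) ∧
        ∀ y : Site (i.1.1.P i.1.2.2) (i.1.2.2 - i.1.2.1), l₀ (embIter (i.1.2.2 - i.1.2.1) y) = cf y) →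
      ∀ (g : SiteL2K ℂ 3 (periodsT3 i.1.1 i.1.2.2) (c₀ L) W₂) (Gb : ℝ), (∀ y, ‖WL2.equiv ℂ _ W₂ g y‖ ≤ Gb) →
        ∀ y, ‖WL2.equiv ℂ _ W₂ (RS i.1.1 i.1.2.1 i.1.2.2 i.2.2.le (c₀ L) (cB L) U₀ g) y‖ ≤ CR L * Gb) ∧ (∀ L : ℕ, 1 < L → 0 ≤ CR L) :=
    ⟨_, fun L hL i U₀ ρ hρ hρα hLift g Gb hg y =>
      norm_equiv_RS_le_member_of_lift i.1.1 i.2.2.le (c₀ := c₀ L) (cB := cB L) (alphaH_pos L hL) U₀ (regPr_mono i.1.1 hρα hρ) i.2.2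
        (alphaH_window_member L hL i le_rfl) one_pos hLift g Gb hg y,
      fun L hL => by
        have hM2 : (2:ℝ) ≤ max 2 (16 / (1:ℝ)) := le_max_left _ _
        have hsM : 0 < Real.sqrt (max 2 (16 / (1:ℝ))) := Real.sqrt_pos.2 (by linarith)
        positivity⟩
  obtain ⟨CR, hrows, h0⟩ := key
  exact ⟨CR, h0, hrows⟩

end Summit.QuantumFields.YangMills.Theorems.Prop7GaugeProjectorRSSupMember

end
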